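import Mathlib
import HarnessLib

/-!
# Common divisors of `fᵏ − 1` and `gᵏ − 1` for complex polynomials (Ailon–Rudnick 2004, Thm. 1)

Topic `Literature/NumberTheory/DiophantineGeometry` (next to `IntegerGCDBound.lean` — the integer
counterpart `gcd(aⁿ−1, bⁿ−1) ≤ exp(εn)` of Bugeaud–Corvaja–Zannier — and `FunctionFieldGCD.lean`,
Corvaja–Zannier's `S`-unit gcd bound over function fields).

N. Ailon, Z. Rudnick, *Torsion points on curves and common divisors of `aᵏ − 1` and `bᵏ − 1`*,
Acta Arith. 113 (2004), no. 1, 31–38 = arXiv:math/0202102 [AilonRudnick2004]; read from the arXiv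
text, p. 3:

"**Theorem 1.** Let `f, g ∈ ℂ[t]` be non-constant polynomials. If `f` and `g` are multiplicatively
independent, then there exists a polynomial `h` such that `gcd(fᵏ − 1, gᵏ − 1) | h` for any `k ≥ 1`.
If, in addition, `gcd(f − 1, g − 1) = 1`, then there is a finite union of proper arithmetic
progressions `∪ dᵢℕ`, `dᵢ ≥ 2`, such that for `k` outside these progressions,
`gcd(fᵏ − 1, gᵏ − 1) = 1`." (p. 3: "Note that [this] is a strong form of" Bugeaud–Corvaja–Zannier's
`gcd(aᵏ−1, bᵏ−1) ≪_ε e^{εk}`; proof, p. 4: Lang's torsion-points theorem (Ihara–Serre–Tate) applied to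
the rational curve `(f(t), g(t))` gives a finite set `S` of `t` with `f(t), g(t)` both roots of
unity, and "the required polynomial `h` can be chosen as `h(t) = ∏_{s∈S} (t − s)^{min(deg f, deg g)}`".)
Multiplicative independence is the paper's (p. 3, l. 11): "`aʳ ≠ bˢ` for `r, s ≥ 1`".

Vendored here AS PRINTED, first part of Theorem 1, as a NAMED FACT (`def … : Prop`, review-queued,
no proof). Rendering: `f g : Polynomial ℂ` non-constant (`0 < natDegree`); independence
`∀ r s ≥ 1, f ^ r ≠ g ^ s`; the gcd is `EuclideanDomain.gcd` in `ℂ[t]` (defined up to a unit —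
immaterial for divisibility; the same spelling as the ABC route item
`Summit.ABC.ABC.Theses.GvfSupportTransfer.FunctionFieldAK`); the polynomial `h` is required to be
NON-ZERO — with `h = 0` the printed sentence would be vacuous (`x ∣ 0` always), and the paper's `h` is
the explicit non-zero product quoted above, so this is the printed meaning, not a strengthening.
The second part (coprimality outside finitely many progressions) is not vendored.

Relevance: the function-field side of the "BCZ ↔ Ailon–Rudnick" comparison used by the refuters of
the ABC route `Summits/ABC/ABC/Theses/GvfSupportTransfer.lean` (items `GenusNegligibleDensity`,
`LinearLawTransfer`): over `ℂ[t]` the gcd profile of `(fᵏ−1, gᵏ−1)` is BOUNDED, over `ℤ` it is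
`e^{o(k)}` (`BugeaudCorvajaZannier2003_thm1`) — `o(height)` on both sides. Not in Mathlib or the tree
(searched `Ailon`, `gcd_pow_sub_one`, `torsion points on curves`: only the one-base identity
`gcd(aᵐ−1, aⁿ−1)` in `ShorRoundFP`).
-/

namespace Literature.NumberTheory.DiophantineGeometry

open Polynomial

/-- **Ailon–Rudnick 2004, Theorem 1 (first part)** (Acta Arith. 113 (2004) 31–38 =
arXiv:math/0202102, p. 3): if `f, g ∈ ℂ[t]` are non-constant and multiplicatively independent
(`fʳ ≠ gˢ` for all `r, s ≥ 1`), then there is a (non-zero) polynomial `h` with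
`gcd(fᵏ − 1, gᵏ − 1) ∣ h` for every `k ≥ 1` — the degree of the gcd is bounded independently of
`k` (proof via Lang's theorem on torsion points on curves; explicitly
`h = ∏_{s∈S}(t − s)^{min(deg f, deg g)}`, `S` = the finitely many `t` with `f(t), g(t)` roots of
unity). Function-field counterpart of `BugeaudCorvajaZannier2003_thm1`. A named fact: users take
`(h : AilonRudnick2004_thm1)`. [cite: AilonRudnick2004, Thm 1] -/
def AilonRudnick2004_thm1 : Prop :=
  ∀ f g : Polynomial ℂ, 0 < f.natDegree → 0 < g.natDegree →
    (∀ r s : ℕ, 1 ≤ r → 1 ≤ s → f ^ r ≠ g ^ s) →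
    ∃ h : Polynomial ℂ, h ≠ 0 ∧ ∀ k : ℕ, 1 ≤ k →
      EuclideanDomain.gcd (f ^ k - 1) (g ^ k - 1) ∣ h

end Literature.NumberTheory.DiophantineGeometry
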